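import Mathlib
import HarnessLib
import HarnessLib.Audit
import Summits.CriticalPhenomena.PercolationContinuityZ3.Theorems.PercNearOneGluingNoHeavyLowerTailHexMSMatchBlockers
import Summits.CriticalPhenomena.PercolationContinuityZ3.Theorems.PercNearOneGluingNoHeavyLowerTailHexMSMatchMS2

/-!
# Instance-level bridges: (MS2) for ONE instance ⟹ (Π2″) ⟹ (MATCH*) for that configuration (hp-7 gen 76)

Support file for crux `stmt-CriticalPhenomena-4575` (route `PercNearOneGluingNoHeavy`), hull-port seat `prim-hp-7` (generation 76);
`--supports stmt-CriticalPhenomena-4575`.  No `sorry`.  Memo: `run/shared/lean/prim/prim-hp-7/FROM-prim-hp-7-g76-ORDER-CERTIFICATES.md` §9.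

Gen 72 reduced the depth-one layer of (MATCH*) to the GLOBAL conjecture `GeneratedDonors.MS2 α`
(`two_mul_card_le_card_clU_scTerms_of_ms2`, `card_le_card_farNbhd_of_ms2`).  The instance-level (MS2) theorems accumulated since
(`…HexMSMatchPureSCTight`, `…HexMSMatchTopsSuffice`, `…HexMSMatchReservedTerms`, `…HexMSMatchCoStar`) prove the inequality for a given
`(P, Q, D₅, D₂)` only.  This file re-runs the two gen-72 bridges with the global hypothesis replaced by the inequality AT THE DERIVED INSTANCE
(proofs verbatim otherwise; the purity hypothesis `C2` of the first bridge drops out, it was only used to invoke `MS2`):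

* `two_mul_card_le_card_clU_scTerms_of_ms2At` — (MS2) at `(P, Q, W ∩ (P \\ Q), {d ∈ Q \\ P | U \ d ∈ W})` ⟹ `2 (#P + #Q + #W) ≤ #clU U (scTerms P Q W)`
  for dead-like blocks;
* `card_le_card_farNbhd_of_ms2At` — the same instance inequality for the two dead classes of a depth-one saturated antipodal instance ⟹
  `#𝒟 ≤ #(farNbhd 𝒟 x (dead U 𝒟 x))` (Hall for the dead set).
-/

namespace Summit.CriticalPhenomena.PercolationContinuityZ3.Theorems

namespace GeneratedDonors

open Finset FinsetFamily

variable {α : Type*} [DecidableEq α]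

section Reduction

variable {U : Finset α}

/-- **The second-difference reduction at one instance** (hp-7 gen 76): as `GeneratedDonors.two_mul_card_le_card_clU_scTerms_of_ms2`,
but assuming the (MS2) inequality only for the instance `(P, Q, D₅, D₂)` derived from the blockers `W` (`D₅ = W ∩ (P \\ Q)`,
`D₂ = {d ∈ Q \\ P | U \ d ∈ W}`), so that every instance-level (MS2) theorem (tight-or-free, one type, co-star, order/incidence
certificates) yields (Π2″) for its dead-like blocks.  The purity hypothesis `C2` is not needed here (it only served to invoke `MS2`). -/
theorem two_mul_card_le_card_clU_scTerms_of_ms2At (P Q W : Finset (Finset α))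
    (hU : ∀ a ∈ P ∪ Q, a ⊆ U) (hPQ : Disjoint P Q)
    (hint : ∀ a ∈ P ∪ Q, ∀ b ∈ P ∪ Q, (a ∩ b).Nonempty) (hcov : ∀ a ∈ P ∪ Q, ∀ b ∈ P ∪ Q, a ∪ b ≠ U)
    (hrep : W ⊆ scReps U P Q) (hWco : ∀ a ∈ W, ∀ b ∈ W, a ≠ U \ b)
    (hms2 : #((P ∪ Q) ∪ ((P \\ Q).filter fun d => d ∈ W) ∪ ((Q \\ P).filter fun d => U \ d ∈ W)) ≤
      #((((P ∪ Q) \\ (P ∪ Q)) ∪ (P \\ ((P \\ Q).filter fun d => d ∈ W))) ∪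
        (Q \\ ((Q \\ P).filter fun d => U \ d ∈ W)))) :
    2 * (#P + #Q + #W) ≤ #(clU U (scTerms P Q W)) := by
  classical
  set F := P ∪ Q with hFdef
  set T := scTerms P Q W with hTdef
  have hcardF : #F = #P + #Q := card_union_of_disjoint hPQ
  have hP : ∀ {a}, a ∈ P → a ∈ F := fun ha => mem_union_left _ ha
  have hQ : ∀ {a}, a ∈ Q → a ∈ F := fun ha => mem_union_right _ ha
  have hcc : ∀ {a : Finset α}, a ⊆ U → U \ (U \ a) = a := fun ha => Finset.sdiff_sdiff_eq_self ha
  have hWU : ∀ w ∈ W, w ⊆ U := fun w hw => subset_of_mem_scReps hU (hrep hw)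
  -- the pure cross differences behind W
  set D₅ : Finset (Finset α) := (P \\ Q).filter fun d => d ∈ W with hD₅def
  set D₂ : Finset (Finset α) := (Q \\ P).filter fun d => U \ d ∈ W with hD₂def
  have hD₅ : D₅ ⊆ P \\ Q := filter_subset _ _
  have hD₂ : D₂ ⊆ Q \\ P := filter_subset _ _
  have hdsubU : ∀ t ∈ (P \\ P) ∪ (Q \\ Q), t ⊆ U := by
    intro t ht
    rcases mem_union.mp ht with ht | ht
    · obtain ⟨a, ha, b, -, rfl⟩ := mem_diffs.mp ht; exact sdiff_subset.trans (hU a (hP ha))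
    · obtain ⟨a, ha, b, -, rfl⟩ := mem_diffs.mp ht; exact sdiff_subset.trans (hU a (hQ ha))
  -- members are neither cross differences nor their own kind: F, D₅, D₂ pairwise disjoint
  have hFD : ∀ d ∈ D₅ ∪ D₂, d ∉ F := by
    intro d hd hdF
    have : d ∈ F \\ F := by
      rcases mem_union.mp hd with hd | hd
      · obtain ⟨a, ha, b, hb, rfl⟩ := mem_diffs.mp (hD₅ hd); exact sdiff_mem_diffs (hP ha) (hQ hb)
      · obtain ⟨a, ha, b, hb, rfl⟩ := mem_diffs.mp (hD₂ hd); exact sdiff_mem_diffs (hQ ha) (hP hb)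
    exact notMem_clU_diffs_of_mem hU hint hcov hdF (mem_clU.mpr (Or.inl this))
  have h52 : Disjoint D₅ D₂ := by
    rw [Finset.disjoint_left]
    intro d h5 h2
    have hw : d ∈ W := (mem_filter.mp h5).2
    have hw' : U \ d ∈ W := (mem_filter.mp h2).2
    exact hWco _ hw' _ hw rfl
  -- #W ≤ #D₅ + #D₂ : w ↦ (w if w ∈ P \\ Q else U \ w)
  have hWD : #W ≤ #(D₅ ∪ D₂) := by
    refine card_le_card_of_injOn (fun w => if w ∈ P \\ Q then w else U \ w) ?_ ?_
    · intro w hw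
      have hw' := hrep (mem_coe.mp hw)
      simp only [mem_coe]
      by_cases hwd : w ∈ P \\ Q
      · rw [if_pos hwd]; exact mem_union_left _ (mem_filter.mpr ⟨hwd, mem_coe.mp hw⟩)
      · rw [if_neg hwd]
        unfold scReps at hw'
        rcases mem_union.mp hw' with h | h
        · exact absurd h hwd
        · obtain ⟨pq, hpq, hpqw⟩ := mem_image.mp h
          obtain ⟨hp₀, hq₀⟩ := mem_product.mp hpq
          have hq₀U : pq.2 ⊆ U := hU _ (hQ hq₀)
          have he_eq : U \ w = pq.2 \ pq.1 := by
            rw [← hpqw]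
            ext i; simp only [mem_sdiff, mem_union]
            constructor
            · rintro ⟨hiU, h⟩
              refine ⟨?_, fun h1 => h (Or.inl h1)⟩
              by_contra h2; exact h (Or.inr ⟨hiU, h2⟩)
            · rintro ⟨hi2, hi1⟩
              exact ⟨hq₀U hi2, fun h => h.elim hi1 (fun h' => h'.2 hi2)⟩
          refine mem_union_right _ (mem_filter.mpr ⟨?_, ?_⟩)
          · rw [he_eq]; exact sdiff_mem_diffs hq₀ hp₀
          · rw [hcc (hWU w (mem_coe.mp hw))]; exact mem_coe.mp hw
    · intro w hw w' hw' hww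
      simp only at hww
      have hwU := hWU w (mem_coe.mp hw); have hw'U := hWU w' (mem_coe.mp hw')
      by_cases h1 : w ∈ P \\ Q <;> by_cases h2 : w' ∈ P \\ Q
      · rwa [if_pos h1, if_pos h2] at hww
      · rw [if_pos h1, if_neg h2] at hww
        exact absurd hww (hWco w (mem_coe.mp hw) w' (mem_coe.mp hw'))
      · rw [if_neg h1, if_pos h2] at hww
        exact absurd hww.symm (hWco w' (mem_coe.mp hw') w (mem_coe.mp hw))
      · rw [if_neg h1, if_neg h2] at hww
        rw [← hcc hwU, hww, hcc hw'U]
  -- (MS2)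
  set T₀ := (F \\ F) ∪ (P \\ D₅) ∪ (Q \\ D₂) with hT₀def
  have hcount : #F + #W ≤ #T₀ := by
    have hFD' : Disjoint F (D₅ ∪ D₂) := Finset.disjoint_right.mpr fun d hd => hFD d hd
    have e1 : #(F ∪ D₅ ∪ D₂) = #F + (#D₅ + #D₂) := by
      rw [union_assoc, card_union_of_disjoint hFD', card_union_of_disjoint h52]
    have e2 : #(D₅ ∪ D₂) = #D₅ + #D₂ := card_union_of_disjoint h52
    have := hms2
    rw [e1] at this
    omega
  -- T₀ ⊆ T, below members, hence disjoint from its complements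
  have hT₀T : T₀ ⊆ T := by
    intro t ht
    rw [hTdef]; unfold scTerms; simp only [mem_union]
    rcases mem_union.mp ht with ht | ht
    · rcases mem_union.mp ht with ht | ht
      · obtain ⟨a, ha, b, hb, rfl⟩ := mem_diffs.mp ht
        rcases mem_union.mp ha with ha | ha <;> rcases mem_union.mp hb with hb | hb
        · exact Or.inl (Or.inl (Or.inl (Or.inl (Or.inl (Or.inl (Or.inl (sdiff_mem_diffs ha hb)))))))
        · exact Or.inl (Or.inl (Or.inl (Or.inl (Or.inl (Or.inr (sdiff_mem_diffs ha hb))))))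
        · exact Or.inl (Or.inl (Or.inl (Or.inl (Or.inr (sdiff_mem_diffs ha hb)))))
        · exact Or.inl (Or.inl (Or.inl (Or.inl (Or.inl (Or.inl (Or.inr (sdiff_mem_diffs ha hb)))))))
      · obtain ⟨p, hp, d, hd, rfl⟩ := mem_diffs.mp ht
        exact Or.inl (Or.inl (Or.inl (Or.inr (mem_diffs.mpr ⟨p, hp, d, (mem_filter.mp hd).2, rfl⟩))))
    · obtain ⟨q, hq, d, hd, rfl⟩ := mem_diffs.mp ht
      refine Or.inl (Or.inr (mem_infs.mpr ⟨q, hq, U \ d, (mem_filter.mp hd).2, ?_⟩))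
      show q ∩ (U \ d) = q \ d
      ext i; simp only [mem_inter, mem_sdiff]
      constructor
      · rintro ⟨hiq, -, hid⟩; exact ⟨hiq, hid⟩
      · rintro ⟨hiq, hid⟩; exact ⟨hiq, hU q (hQ hq) hiq, hid⟩
  have hbelow : ∀ t ∈ T₀, ∃ f ∈ F, t ⊆ f := by
    intro t ht
    rcases mem_union.mp ht with ht | ht
    · rcases mem_union.mp ht with ht | ht
      · obtain ⟨a, ha, b, -, rfl⟩ := mem_diffs.mp ht; exact ⟨a, ha, sdiff_subset⟩
      · obtain ⟨p, hp, d, -, rfl⟩ := mem_diffs.mp ht; exact ⟨p, hP hp, sdiff_subset⟩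
    · obtain ⟨q, hq, d, -, rfl⟩ := mem_diffs.mp ht; exact ⟨q, hQ hq, sdiff_subset⟩
  set Tc := T₀.image fun t => U \ t with hTcdef
  have hcardTc : #Tc = #T₀ := by
    refine card_image_of_injOn ?_
    intro t ht t' ht' htt
    obtain ⟨f, hf, htf⟩ := hbelow t (mem_coe.mp ht)
    obtain ⟨f', hf', htf'⟩ := hbelow t' (mem_coe.mp ht')
    simp only at htt
    rw [← hcc (htf.trans (hU f hf)), htt, hcc (htf'.trans (hU f' hf'))]
  have hdisj : Disjoint T₀ Tc := by
    rw [Finset.disjoint_left]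
    intro t ht htc
    obtain ⟨t', ht', htt⟩ := mem_image.mp htc
    obtain ⟨f, hf, htf⟩ := hbelow t ht
    obtain ⟨f', hf', htf'⟩ := hbelow t' ht'
    apply hcov f hf f' hf'
    apply Subset.antisymm (union_subset (hU f hf) (hU f' hf'))
    intro i hiU
    rw [mem_union]
    by_cases hif' : i ∈ t'
    · exact Or.inr (htf' hif')
    · have : i ∈ U \ t' := mem_sdiff.mpr ⟨hiU, hif'⟩
      rw [htt] at this
      exact Or.inl (htf this)
  have hbig : T₀ ∪ Tc ⊆ clU U T := by
    intro t ht
    rcases mem_union.mp ht with ht | ht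
    · exact mem_clU.mpr (Or.inl (hT₀T ht))
    · obtain ⟨t', ht', rfl⟩ := mem_image.mp ht
      exact mem_clU.mpr (Or.inr ⟨t', hT₀T ht', rfl⟩)
  have := card_le_card hbig
  rw [card_union_of_disjoint hdisj, hcardTc] at this
  omega

end Reduction

section DepthOne

variable {U : Finset α} {𝒟 : Finset (Finset α)} {x : Finset α → ZMod 6}

/-- **(MS2) at the instance ⟹ (MATCH*) for a depth-one saturated two-class instance** (hp-7 gen 76): as
`GeneratedDonors.card_le_card_farNbhd_of_ms2`, but assuming the (MS2) inequality only for the two-class dead family `P ⊔ Q` (labels `i`, `i+1`)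
with the designated differences derived from the alive blockers of label `i+5`. -/
theorem card_le_card_farNbhd_of_ms2At (hU : ∀ a ∈ 𝒟, a ⊆ U) (hco : ∀ a ∈ 𝒟, U \ a ∈ 𝒟)
    (hanti : ∀ a ∈ 𝒟, x (U \ a) = x a + 3) (i : ZMod 6)
    (hlab : ∀ a ∈ dead U 𝒟 x, x a = i ∨ x a = i + 1 ∨ x a = i + 3 ∨ x a = i + 4)
    (hdepth : ∀ d ∈ 𝒟, d ∉ dead U 𝒟 x →
      (x d = i + 5 ∧ d ∈ scReps U ((dead U 𝒟 x).filter fun a => x a = i) ((dead U 𝒟 x).filter fun a => x a = i + 1)) ∨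
      (x d = i + 2 ∧ U \ d ∈ scReps U ((dead U 𝒟 x).filter fun a => x a = i) ((dead U 𝒟 x).filter fun a => x a = i + 1)))
    (hms2 : #((((dead U 𝒟 x).filter fun a => x a = i) ∪ ((dead U 𝒟 x).filter fun a => x a = i + 1)) ∪
        ((((dead U 𝒟 x).filter fun a => x a = i) \\ ((dead U 𝒟 x).filter fun a => x a = i + 1)).filter fun d => d ∈ ((𝒟 \ dead U 𝒟 x).filter fun a => x a = i + 5)) ∪
        ((((dead U 𝒟 x).filter fun a => x a = i + 1) \\ ((dead U 𝒟 x).filter fun a => x a = i)).filter fun d => U \ d ∈ ((𝒟 \ dead U 𝒟 x).filter fun a => x a = i + 5))) ≤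
      #((((((dead U 𝒟 x).filter fun a => x a = i) ∪ ((dead U 𝒟 x).filter fun a => x a = i + 1)) \\ (((dead U 𝒟 x).filter fun a => x a = i) ∪ ((dead U 𝒟 x).filter fun a => x a = i + 1))) ∪
        (((dead U 𝒟 x).filter fun a => x a = i) \\ ((((dead U 𝒟 x).filter fun a => x a = i) \\ ((dead U 𝒟 x).filter fun a => x a = i + 1)).filter fun d => d ∈ ((𝒟 \ dead U 𝒟 x).filter fun a => x a = i + 5)))) ∪
        (((dead U 𝒟 x).filter fun a => x a = i + 1) \\ ((((dead U 𝒟 x).filter fun a => x a = i + 1) \\ ((dead U 𝒟 x).filter fun a => x a = i)).filter fun d => U \ d ∈ ((𝒟 \ dead U 𝒟 x).filter fun a => x a = i + 5))))) :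
    #𝒟 ≤ #(farNbhd 𝒟 x (dead U 𝒟 x)) := by
  classical
  obtain ⟨n01, n30, n31, n40, n41, n85, n50, n51, n20, n21, n25, n53, n54, e33, e43, e23⟩ := label_facts i
  set P : Finset (Finset α) := (dead U 𝒟 x).filter fun a => x a = i with hPdef
  set Q : Finset (Finset α) := (dead U 𝒟 x).filter fun a => x a = i + 1 with hQdef
  set W : Finset (Finset α) := (𝒟 \ dead U 𝒟 x).filter fun a => x a = i + 5 with hWdef
  have hP : ∀ p ∈ P, p ∈ dead U 𝒟 x ∧ x p = i := fun p hp => by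
    have h := mem_filter.mp hp; exact ⟨h.1, h.2⟩
  have hQ : ∀ q ∈ Q, q ∈ dead U 𝒟 x ∧ x q = i + 1 := fun q hq => by
    have h := mem_filter.mp hq; exact ⟨h.1, h.2⟩
  have hW : ∀ w ∈ W, (w ∈ 𝒟 ∧ w ∉ dead U 𝒟 x) ∧ x w = i + 5 := fun w hw => by
    have h := mem_filter.mp hw; exact ⟨mem_sdiff.mp h.1, h.2⟩
  have hdD : ∀ {a}, a ∈ dead U 𝒟 x → a ∈ 𝒟 := fun ha => (mem_filter.mp ha).1
  have hcc : ∀ {a}, a ⊆ U → U \ (U \ a) = a := fun ha => Finset.sdiff_sdiff_eq_self ha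
  -- the hypotheses of the pure inequality for (P, Q, W)
  have h1 : ∀ a ∈ P ∪ Q, a ⊆ U := by
    intro a ha
    rcases mem_union.mp ha with ha | ha
    · exact hU a (hdD (hP a ha).1)
    · exact hU a (hdD (hQ a ha).1)
  have h2 : Disjoint P Q := by
    rw [Finset.disjoint_left]
    intro a haP haQ
    exact n01 ((hP a haP).2.symm.trans (hQ a haQ).2)
  have hPQlab : ∀ a ∈ P ∪ Q, a ∈ dead U 𝒟 x ∧ (x a = i ∨ x a = i + 1) := by
    intro a ha
    rcases mem_union.mp ha with ha | ha
    · exact ⟨(hP a ha).1, Or.inl (hP a ha).2⟩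
    · exact ⟨(hQ a ha).1, Or.inr (hQ a ha).2⟩
  -- dead-like: pairwise intersecting and non-covering (labels i, i+1 are close)
  have hint : ∀ a ∈ P ∪ Q, ∀ b ∈ P ∪ Q, (a ∩ b).Nonempty := fun a ha b hb =>
    inter_nonempty_of_dead_of_close (hPQlab a ha).1 (hdD (hPQlab b hb).1)
      (close_of_mem_pair (hPQlab a ha).2 (hPQlab b hb).2)
  have hcov : ∀ a ∈ P ∪ Q, ∀ b ∈ P ∪ Q, a ∪ b ≠ U := fun a ha b hb =>
    union_ne_of_dead_of_close hU hco hanti (hPQlab a ha).1 (hdD (hPQlab b hb).1)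
      (close_of_mem_pair (hPQlab a ha).2 (hPQlab b hb).2)
  have h4 : W ⊆ scReps U P Q := by
    intro w hw
    obtain ⟨⟨hwD, hwa⟩, hxw⟩ := hW w hw
    rcases hdepth w hwD hwa with ⟨-, h⟩ | ⟨h2', -⟩
    · exact h
    · exact absurd (hxw.symm.trans h2') n25.symm
  have h5 : ∀ a ∈ W, ∀ b ∈ W, a ≠ U \ b := by
    intro a ha b hb hab
    have hxa := (hW a ha).2
    have hxb : x a = x b + 3 := by rw [hab]; exact hanti b (hW b hb).1.1
    rw [(hW b hb).2] at hxb
    exact n85 (hxb.symm.trans hxa)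
  -- the pure inequality from (MS2), and the embedding of the terms
  have hineq : 2 * (#P + #Q + #W) ≤ #(clU U (scTerms P Q W)) :=
    two_mul_card_le_card_clU_scTerms_of_ms2At P Q W h1 h2 hint hcov h4 h5 hms2
  have hsub : clU U (scTerms P Q W) ⊆ farNbhd 𝒟 x (dead U 𝒟 x) :=
    clU_scTerms_subset_farNbhd hU hco hanti i hP hQ (fun w hw => ⟨(hW w hw).1.1, (hW w hw).2⟩)
  -- counting 𝒟: every member or its complement lies in P ∪ Q ∪ W
  set A : Finset (Finset α) := 𝒟.filter fun d => x d = i ∨ x d = i + 1 ∨ x d = i + 5 with hAdef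
  set B : Finset (Finset α) := 𝒟.filter fun d => ¬ (x d = i ∨ x d = i + 1 ∨ x d = i + 5) with hBdef
  have hmemPQW : ∀ d ∈ 𝒟, (x d = i ∨ x d = i + 1 ∨ x d = i + 5) → d ∈ P ∪ Q ∪ W := by
    intro d hd hx
    simp only [mem_union]
    by_cases hdead : d ∈ dead U 𝒟 x
    · rcases hx with h | h | h
      · exact Or.inl (Or.inl (mem_filter.mpr ⟨hdead, h⟩))
      · exact Or.inl (Or.inr (mem_filter.mpr ⟨hdead, h⟩))
      · exfalso
        rcases hlab d hdead with h' | h' | h' | h'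
        · exact n50 (h.symm.trans h')
        · exact n51 (h.symm.trans h')
        · exact n53 (h.symm.trans h')
        · exact n54 (h.symm.trans h')
    · rcases hdepth d hd hdead with ⟨h5', -⟩ | ⟨h2', -⟩
      · exact Or.inr (mem_filter.mpr ⟨mem_sdiff.mpr ⟨hd, hdead⟩, h5'⟩)
      · exfalso
        rcases hx with h | h | h
        · exact n20 (h2'.symm.trans h)
        · exact n21 (h2'.symm.trans h)
        · exact n25 (h2'.symm.trans h)
  have hA : A ⊆ P ∪ Q ∪ W := fun d hd => hmemPQW d (mem_filter.mp hd).1 (mem_filter.mp hd).2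
  have hB : B.image (fun d => U \ d) ⊆ P ∪ Q ∪ W := by
    intro e he
    obtain ⟨d, hd, rfl⟩ := mem_image.mp he
    obtain ⟨hdD', hnot⟩ := mem_filter.mp hd
    refine hmemPQW (U \ d) (hco d hdD') ?_
    rw [hanti d hdD']
    by_cases hdead : d ∈ dead U 𝒟 x
    · rcases hlab d hdead with h | h | h | h
      · exact absurd (Or.inl h) hnot
      · exact absurd (Or.inr (Or.inl h)) hnot
      · rw [h]; exact Or.inl e33
      · rw [h]; exact Or.inr (Or.inl e43)
    · rcases hdepth d hdD' hdead with ⟨h5', -⟩ | ⟨h2', -⟩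
      · exact absurd (Or.inr (Or.inr h5')) hnot
      · rw [h2']; exact Or.inr (Or.inr e23)
  have hinjB : Set.InjOn (fun d : Finset α => U \ d) ↑B := by
    intro d hd e he hde
    have hdU : d ⊆ U := hU d (mem_filter.mp (mem_coe.mp hd)).1
    have heU : e ⊆ U := hU e (mem_filter.mp (mem_coe.mp he)).1
    have h1' := congrArg (fun t => U \ t) hde
    simp only [hcc hdU, hcc heU] at h1'
    exact h1'
  have hsplit : #A + #B = #𝒟 := card_filter_add_card_filter_not _
  have hcardA : #A ≤ #(P ∪ Q ∪ W) := card_le_card hA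
  have hcardB : #B ≤ #(P ∪ Q ∪ W) := by
    rw [← card_image_of_injOn hinjB]; exact card_le_card hB
  have hunion : #(P ∪ Q ∪ W) ≤ #P + #Q + #W :=
    (card_union_le _ _).trans (Nat.add_le_add_right (card_union_le _ _) _)
  have hT := card_le_card hsub
  omega

end DepthOne

end GeneratedDonors

end Summit.CriticalPhenomena.PercolationContinuityZ3.Theorems
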